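import Mathlib
import Summits.Ventures.DiscreteObjects.Mahler.CensusKernelDeg26Tables
import Summits.Ventures.DiscreteObjects.Mahler.CensusSearchPacked

/-!
# Kernel census, degree 26 at `B = 20/17` (part P138): kernel checks of the nodes `(c₁,c₂)` from `(1,0,1,1,1)` to `(1,0,1,1,1)`

Cell `pub-namedobj`, seats `pub-namedobj-mahler-g19`/`g20` (pipeline of seats g12–g18). Framing: lottery ticket; floor = certified bounds/negative ranges.

Part of the kernel proof of `DegreeCensus 26 (20/17) coresDeg26` (tables in part Tables; validity in part A: census search with
kernel-certified explicit-auxiliary-function cuts and certified leaf thresholds at `B = 20/17`; 4626568 leaves with `c_1 >= 0`,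
120525 small-cyclotomic survivors dropped in the kernel, 39903 survivors certified by extended certificates `CertX`: base red/cyc/exc
or trace-Graeffe `tgr`).  This part holds, for the search nodes listed below, one kernel check each of the PACKED search `censusSearchPs` (mahler g20,
`CensusSearchPacked`; `decide` with kernel reduction, standard axioms) transferred to the census statement by `forall_certX_of_allCertifiedPs`; nodes over the
per-theorem budget are split by the next coefficient and re-assembled by a node lemma.
CONTROL/replication (Lehmer's bound at degree 26; print complete to degree 44), not new ground.
-/

namespace Summit.Ventures.DiscreteObjects.Mahler

open Polynomial

/-- Certificates for the 0 certified survivors below the node `[1, 0, 1, 1, 1, 1]` (1942 leaves; 133 small-cyclotomic survivors dropped in the kernel), in search order. -/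
def certs26_p1_p0_p1_p1_p1_p1 : List CertX :=
  []
/-- Kernel check of the node `[1, 0, 1, 1, 1, 1]` (packed search `censusSearchPs`, transferred to the census statement). -/
theorem certified26n_p1_p0_p1_p1_p1_p1 : ∀ a ∈ censusSearchC T26 CT26 7 [1, 0, 1, 1, 1, 1] (psumsRev [1, 0, 1, 1, 1, 1] 6),
    ∃ c, checkCertX 20 17 13 coresDeg26 LC26 (1 :: palC a) c = true :=
  forall_certX_of_allCertifiedPs (NJ := 3) T26_lt T26_len (by norm_num) (by simp) (by simp) certs26_p1_p0_p1_p1_p1_p1 (by decide +kernel)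

/-- Certificates for the 0 certified survivors below the node `[1, 0, 1, 1, 1, 2]` (1908 leaves; 122 small-cyclotomic survivors dropped in the kernel), in search order. -/
def certs26_p1_p0_p1_p1_p1_p2 : List CertX :=
  []
/-- Kernel check of the node `[1, 0, 1, 1, 1, 2]` (packed search `censusSearchPs`, transferred to the census statement). -/
theorem certified26n_p1_p0_p1_p1_p1_p2 : ∀ a ∈ censusSearchC T26 CT26 7 [1, 0, 1, 1, 1, 2] (psumsRev [1, 0, 1, 1, 1, 2] 6),
    ∃ c, checkCertX 20 17 13 coresDeg26 LC26 (1 :: palC a) c = true :=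
  forall_certX_of_allCertifiedPs (NJ := 3) T26_lt T26_len (by norm_num) (by simp) (by simp) certs26_p1_p0_p1_p1_p1_p2 (by decide +kernel)

/-- Every survivor below the node `[1, 0, 1, 1, 1]` carries a valid certificate (by cases on the next coefficient). -/
theorem certified26n_p1_p0_p1_p1_p1 : ∀ a ∈ censusSearchC T26 CT26 8 [1, 0, 1, 1, 1] (psumsRev [1, 0, 1, 1, 1] 5),
    ∃ c, checkCertX 20 17 13 coresDeg26 LC26 (1 :: palC a) c = true := by
  intro a ha
  rw [mem_censusSearchC_node_iff (pre := [1, 0, 1, 1, 1]) (n := 5) rfl, (by decide +kernel : nodeLoC T26 CT26 [1, 0, 1, 1, 1] (psumsRev [1, 0, 1, 1, 1] 5) = 1), (by decide +kernel : nodeHiC T26 CT26 [1, 0, 1, 1, 1] (psumsRev [1, 0, 1, 1, 1] 5) = 2)] at ha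
  obtain ⟨ak, hak, ha⟩ := ha
  simp only [List.cons_append, List.nil_append, Nat.reduceAdd] at ha
  rw [mem_icc] at hak
  obtain ⟨hlo, hhi⟩ := hak
  interval_cases ak
  · exact certified26n_p1_p0_p1_p1_p1_p1 a ha
  · exact certified26n_p1_p0_p1_p1_p1_p2 a ha

end Summit.Ventures.DiscreteObjects.Mahler
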